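import Literature.MathematicalPhysics.KineticTheory.HardSphereCampbellFluxNull
import Literature.Analysis.FluidPDE.HardSphereScattering
import HarnessLib

/-!
# Restricted flux integrals: monotone convergence and the flux-null hard-core defect

Tools for the LOWER bound of the discharge of the stationary collision-rate (Campbell / special-flow)
identity `HardSphereCampbellFormula` (Cercignani–Illner–Pulvirenti 1994, App. 4.A): flux integrals
`∫ dz ∫ dω ε^{d-1}⟪ω, v_a − v_b⟫₊ (1_T G)(z^{ab}_ω)` of a mark restricted to a measurable set `T` of
contact configurations are jointly measurable (`campbell_measurable_setFluxIntegrand`), pass to the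
limit along increasing `T` (`campbell_iSup_lintegral_setFlux`), and the hard-core indicator `1_{D_ε}`
(all pairs at distance `≥ ε`) is dominated by the strict restriction "all OTHER pairs at distance
`> ε`" up to the flux-null event "another pair at distance exactly `ε`"
(`campbell_pairFlux_le_strictFlux`, from `campbell_volume_preimage_otherContact_null`).

## References

* C. Cercignani, R. Illner, M. Pulvirenti, *The Mathematical Theory of Dilute Gases*, Springer
  (1994), §4.2, App. 4.A pp. 107–111.
-/

open MeasureTheory Set Function Filter Metric Topology
open scoped ENNReal NNReal RealInnerProductSpace

namespace Literature.MathematicalPhysics.KineticTheory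

open Literature.Analysis.FluidPDE

noncomputable section

variable {d : Type*} [Fintype d] {N : ℕ} {ε : ℝ}

/-! ### Flux integrals restricted to a measurable set of contact configurations -/

/-- The flux integrand with a mark restricted to a measurable set of contact configurations is
jointly measurable in (configuration, direction). [folklore] -/
theorem campbell_measurable_setFluxIntegrand (ε : ℝ) {S : Set (Config N d (UnitAddTorus d))}
    (hS : MeasurableSet S) {G : Config N d (UnitAddTorus d) → ℝ≥0∞} (hG : Measurable G) (a b : Fin N) :
    Measurable fun p : Config N d (UnitAddTorus d) × Metric.sphere (0 : EuclideanSpace ℝ d) 1 =>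
      ENNReal.ofReal (ε ^ (Fintype.card d - 1) * ⟪((p.2 : EuclideanSpace ℝ d)), (p.1 a).2 - (p.1 b).2⟫) *
        S.indicator G (contactInsert ε a b (p.2 : EuclideanSpace ℝ d) p.1) := by
  have hω : Measurable fun p : Config N d (UnitAddTorus d) × Metric.sphere (0 : EuclideanSpace ℝ d) 1 =>
      (p.2 : EuclideanSpace ℝ d) := measurable_subtype_coe.comp measurable_snd
  have hv : ∀ k : Fin N, Measurable fun p : Config N d (UnitAddTorus d) ×
      Metric.sphere (0 : EuclideanSpace ℝ d) 1 => (p.1 k).2 :=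
    fun k => measurable_snd.comp ((measurable_pi_apply k).comp measurable_fst)
  have h1 : Measurable fun p : Config N d (UnitAddTorus d) × Metric.sphere (0 : EuclideanSpace ℝ d) 1 =>
      ε ^ (Fintype.card d - 1) * ⟪((p.2 : EuclideanSpace ℝ d)), (p.1 a).2 - (p.1 b).2⟫ :=
    measurable_const.mul (hω.inner ((hv a).sub (hv b)))
  exact h1.ennreal_ofReal.mul ((hG.indicator hS).comp (measurable_contactInsert_prod ε a b))

/-- **Monotone convergence of restricted flux integrals**: for an increasing sequence of measurable
sets `T n` of contact configurations with union `T'`,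
`⨆ₙ ∫ dz ∫ dω w (1_{T n} G)(z^{ab}_ω) = ∫ dz ∫ dω w (1_{T'} G)(z^{ab}_ω)`. [folklore] -/
theorem campbell_iSup_lintegral_setFlux (ε : ℝ) (a b : Fin N)
    {G : Config N d (UnitAddTorus d) → ℝ≥0∞} (hG : Measurable G)
    (T : ℕ → Set (Config N d (UnitAddTorus d))) (hTm : ∀ n, MeasurableSet (T n)) (hmono : Monotone T)
    (T' : Set (Config N d (UnitAddTorus d))) (hT' : ∀ x, x ∈ T' ↔ ∃ n, x ∈ T n) :
    (⨆ n, ∫⁻ z : Config N d (UnitAddTorus d), ∫⁻ ω : Metric.sphere (0 : EuclideanSpace ℝ d) 1,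
        ENNReal.ofReal (ε ^ (Fintype.card d - 1) * ⟪((ω : EuclideanSpace ℝ d)), (z a).2 - (z b).2⟫) *
          (T n).indicator G (contactInsert ε a b (ω : EuclideanSpace ℝ d) z)
        ∂(volume : Measure (EuclideanSpace ℝ d)).toSphere) =
      ∫⁻ z : Config N d (UnitAddTorus d), ∫⁻ ω : Metric.sphere (0 : EuclideanSpace ℝ d) 1,
        ENNReal.ofReal (ε ^ (Fintype.card d - 1) * ⟪((ω : EuclideanSpace ℝ d)), (z a).2 - (z b).2⟫) *
          T'.indicator G (contactInsert ε a b (ω : EuclideanSpace ℝ d) z)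
        ∂(volume : Measure (EuclideanSpace ℝ d)).toSphere := by
  set f : ℕ → Config N d (UnitAddTorus d) × Metric.sphere (0 : EuclideanSpace ℝ d) 1 → ℝ≥0∞ :=
    fun n p => ENNReal.ofReal (ε ^ (Fintype.card d - 1) * ⟪((p.2 : EuclideanSpace ℝ d)), (p.1 a).2 - (p.1 b).2⟫) *
      (T n).indicator G (contactInsert ε a b (p.2 : EuclideanSpace ℝ d) p.1) with hfdef
  have hf : ∀ n, Measurable (f n) := fun n => campbell_measurable_setFluxIntegrand ε (hTm n) hG a b
  have hpt_mono : ∀ p, Monotone fun n => f n p := fun p i j hij =>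
    mul_le_mul' le_rfl (indicator_le_indicator_of_subset (hmono hij) (fun _ => zero_le) _)
  have hpt_sup : ∀ p : Config N d (UnitAddTorus d) × Metric.sphere (0 : EuclideanSpace ℝ d) 1,
      (⨆ n, f n p) = ENNReal.ofReal (ε ^ (Fintype.card d - 1) *
          ⟪((p.2 : EuclideanSpace ℝ d)), (p.1 a).2 - (p.1 b).2⟫) *
        T'.indicator G (contactInsert ε a b (p.2 : EuclideanSpace ℝ d) p.1) := by
    intro p
    simp only [hfdef]
    rw [← ENNReal.mul_iSup]
    congr 1
    by_cases hx : contactInsert ε a b (p.2 : EuclideanSpace ℝ d) p.1 ∈ T'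
    · obtain ⟨n₀, hn₀⟩ := (hT' _).1 hx
      refine le_antisymm (iSup_le fun n => ?_) ?_
      · exact indicator_le_indicator_of_subset (fun y hy => (hT' y).2 ⟨n, hy⟩) (fun _ => zero_le) _
      · rw [indicator_of_mem hx]
        refine le_iSup_of_le n₀ ?_
        rw [indicator_of_mem hn₀]
    · rw [indicator_of_notMem hx]
      have hn : ∀ n, contactInsert ε a b (p.2 : EuclideanSpace ℝ d) p.1 ∉ T n :=
        fun n hn => hx ((hT' _).2 ⟨n, hn⟩)
      simp [indicator_of_notMem (hn _)]
  calc (⨆ n, ∫⁻ z : Config N d (UnitAddTorus d), ∫⁻ ω : Metric.sphere (0 : EuclideanSpace ℝ d) 1,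
          f n (z, ω) ∂(volume : Measure (EuclideanSpace ℝ d)).toSphere)
      = ∫⁻ z : Config N d (UnitAddTorus d), ⨆ n, ∫⁻ ω : Metric.sphere (0 : EuclideanSpace ℝ d) 1,
          f n (z, ω) ∂(volume : Measure (EuclideanSpace ℝ d)).toSphere :=
        (lintegral_iSup (fun n => (hf n).lintegral_prod_right')
          (fun i j hij z => lintegral_mono fun ω => hpt_mono (z, ω) hij)).symm
    _ = ∫⁻ z : Config N d (UnitAddTorus d), ∫⁻ ω : Metric.sphere (0 : EuclideanSpace ℝ d) 1,
          ⨆ n, f n (z, ω) ∂(volume : Measure (EuclideanSpace ℝ d)).toSphere :=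
        lintegral_congr fun z => (lintegral_iSup (fun n => (hf n).comp measurable_prodMk_left)
          (fun i j hij ω => hpt_mono (z, ω) hij)).symm
    _ = _ := lintegral_congr fun z => lintegral_congr fun ω => hpt_sup (z, ω)

/-- **The hard-core indicator versus the strict one** (flux-null difference): for `0 < ε < 1/2`,
`a ≠ b` and a measurable mark `G ≥ 0`, the pair flux of `G` (hard-core indicator `1_{D_ε}`: all pairs
at distance `≥ ε`) is at most the flux of `G` restricted to contact configurations all of whose
OTHER pairs are at distance `> ε` — the two differ only on the event "another pair at distance
exactly `ε`", which is flux-null (`campbell_volume_preimage_otherContact_null`). [folklore] -/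
theorem campbell_pairFlux_le_strictFlux (hε : 0 < ε) {a b : Fin N}
    {G : Config N d (UnitAddTorus d) → ℝ≥0∞} (hG : Measurable G) :
    ∫⁻ z : Config N d (UnitAddTorus d), ∫⁻ ω : Metric.sphere (0 : EuclideanSpace ℝ d) 1,
        ENNReal.ofReal (ε ^ (Fintype.card d - 1) * ⟪((ω : EuclideanSpace ℝ d)), (z a).2 - (z b).2⟫) *
          (hardSphereDomain (Torus.geometry d) N ε).indicator G (contactInsert ε a b (ω : EuclideanSpace ℝ d) z)
        ∂(volume : Measure (EuclideanSpace ℝ d)).toSphere ≤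
      ∫⁻ z : Config N d (UnitAddTorus d), ∫⁻ ω : Metric.sphere (0 : EuclideanSpace ℝ d) 1,
        ENNReal.ofReal (ε ^ (Fintype.card d - 1) * ⟪((ω : EuclideanSpace ℝ d)), (z a).2 - (z b).2⟫) *
          {w : Config N d (UnitAddTorus d) | Alexander.OthersFar ε 0 w a b}.indicator G
            (contactInsert ε a b (ω : EuclideanSpace ℝ d) z)
        ∂(volume : Measure (EuclideanSpace ℝ d)).toSphere := by
  haveI : SigmaFinite (volume : Measure (UnitAddTorus d × EuclideanSpace ℝ d)) := inferInstance
  haveI : SigmaFinite (volume : Measure (Config N d (UnitAddTorus d))) := inferInstance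
  haveI : SFinite ((volume : Measure (EuclideanSpace ℝ d)).toSphere) := inferInstance
  set Bad : Set (Config N d (UnitAddTorus d)) := {w | ∃ k l : Fin N, k ≠ l ∧
    ({k, l} : Finset (Fin N)) ≠ {a, b} ∧ ‖(Torus.geometry d).sepVec (w k).1 (w l).1‖ = ε} with hBad
  set T : Set (Config N d (UnitAddTorus d)) := {w | Alexander.OthersFar ε 0 w a b} with hT
  have hTm : MeasurableSet T := Alexander.measurableSet_othersFar ε 0 a b
  have hBadm : MeasurableSet Bad := by
    have : Bad = ⋃ k : Fin N, ⋃ l : Fin N, {w | k ≠ l ∧ ({k, l} : Finset (Fin N)) ≠ {a, b} ∧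
        ‖(Torus.geometry d).sepVec (w k).1 (w l).1‖ = ε} := by
      ext w; simp [hBad]
    rw [this]
    refine MeasurableSet.iUnion fun k => MeasurableSet.iUnion fun l => ?_
    by_cases hkl : k ≠ l ∧ ({k, l} : Finset (Fin N)) ≠ {a, b}
    · have : {w : Config N d (UnitAddTorus d) | k ≠ l ∧ ({k, l} : Finset (Fin N)) ≠ {a, b} ∧
          ‖(Torus.geometry d).sepVec (w k).1 (w l).1‖ = ε} =
          {w | ‖(Torus.geometry d).sepVec (w k).1 (w l).1‖ = ε} := by
        ext w; simp [hkl.1, hkl.2]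
      rw [this]
      exact measurableSet_eq_fun ((Torus.isMeasurable_geometry (d := d)).measurable_sepVec_config k l).norm
        measurable_const
    · have : {w : Config N d (UnitAddTorus d) | k ≠ l ∧ ({k, l} : Finset (Fin N)) ≠ {a, b} ∧
          ‖(Torus.geometry d).sepVec (w k).1 (w l).1‖ = ε} = ∅ := by
        ext w
        simp only [mem_setOf_eq, mem_empty_iff_false, iff_false]
        exact fun h => hkl ⟨h.1, h.2.1⟩
      rw [this]
      exact MeasurableSet.empty
  -- pointwise: `1_D G ≤ 1_T G + 1_Bad G`
  have hpt : ∀ x : Config N d (UnitAddTorus d),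
      (hardSphereDomain (Torus.geometry d) N ε).indicator G x ≤ T.indicator G x + Bad.indicator G x := by
    intro x
    by_cases hxD : x ∈ hardSphereDomain (Torus.geometry d) N ε
    · rw [indicator_of_mem hxD]
      by_cases hxT : x ∈ T
      · rw [indicator_of_mem hxT]; exact le_self_add
      · have hxB : x ∈ Bad := by
          simp only [hT, mem_setOf_eq, Alexander.OthersFar, not_forall, not_lt, add_zero] at hxT
          obtain ⟨k, l, hkl, hne, hle⟩ := hxT
          exact ⟨k, l, hkl, hne, le_antisymm hle (hxD k l hkl)⟩
        rw [indicator_of_mem hxB]; exact le_add_self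
    · rw [indicator_of_notMem hxD]; exact bot_le
  -- the bad part integrates to zero
  have hbad0 : ∫⁻ z : Config N d (UnitAddTorus d), ∫⁻ ω : Metric.sphere (0 : EuclideanSpace ℝ d) 1,
      ENNReal.ofReal (ε ^ (Fintype.card d - 1) * ⟪((ω : EuclideanSpace ℝ d)), (z a).2 - (z b).2⟫) *
        Bad.indicator G (contactInsert ε a b (ω : EuclideanSpace ℝ d) z)
      ∂(volume : Measure (EuclideanSpace ℝ d)).toSphere = 0 := by
    have hm := campbell_measurable_setFluxIntegrand ε hBadm hG a b
    rw [lintegral_lintegral_swap hm.aemeasurable]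
    have hzero : ∀ ω : Metric.sphere (0 : EuclideanSpace ℝ d) 1, ∫⁻ z : Config N d (UnitAddTorus d),
        ENNReal.ofReal (ε ^ (Fintype.card d - 1) * ⟪((ω : EuclideanSpace ℝ d)), (z a).2 - (z b).2⟫) *
          Bad.indicator G (contactInsert ε a b (ω : EuclideanSpace ℝ d) z) = 0 := by
      intro ω
      have hnull := campbell_volume_preimage_otherContact_null (d := d) hε.ne' a b (ω : EuclideanSpace ℝ d)
      have hae : ∀ᵐ z : Config N d (UnitAddTorus d), contactInsert ε a b (ω : EuclideanSpace ℝ d) z ∉ Bad :=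
        measure_eq_zero_iff_ae_notMem.1 hnull
      rw [lintegral_congr_ae (hae.mono fun z hz => by
        show ENNReal.ofReal (ε ^ (Fintype.card d - 1) * ⟪((ω : EuclideanSpace ℝ d)), (z a).2 - (z b).2⟫) *
          Bad.indicator G (contactInsert ε a b (ω : EuclideanSpace ℝ d) z) = (fun _ => (0 : ℝ≥0∞)) z
        rw [indicator_of_notMem hz, mul_zero]), lintegral_zero]
    rw [lintegral_congr hzero, lintegral_zero]
  calc _ ≤ ∫⁻ z : Config N d (UnitAddTorus d), ∫⁻ ω : Metric.sphere (0 : EuclideanSpace ℝ d) 1,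
          (ENNReal.ofReal (ε ^ (Fintype.card d - 1) * ⟪((ω : EuclideanSpace ℝ d)), (z a).2 - (z b).2⟫) *
            T.indicator G (contactInsert ε a b (ω : EuclideanSpace ℝ d) z) +
          ENNReal.ofReal (ε ^ (Fintype.card d - 1) * ⟪((ω : EuclideanSpace ℝ d)), (z a).2 - (z b).2⟫) *
            Bad.indicator G (contactInsert ε a b (ω : EuclideanSpace ℝ d) z))
          ∂(volume : Measure (EuclideanSpace ℝ d)).toSphere := by
        refine lintegral_mono fun z => lintegral_mono fun ω => ?_
        rw [← mul_add]
        exact mul_le_mul' le_rfl (hpt _)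
    _ = (∫⁻ z : Config N d (UnitAddTorus d), ∫⁻ ω : Metric.sphere (0 : EuclideanSpace ℝ d) 1,
          ENNReal.ofReal (ε ^ (Fintype.card d - 1) * ⟪((ω : EuclideanSpace ℝ d)), (z a).2 - (z b).2⟫) *
            T.indicator G (contactInsert ε a b (ω : EuclideanSpace ℝ d) z)
          ∂(volume : Measure (EuclideanSpace ℝ d)).toSphere) +
        ∫⁻ z : Config N d (UnitAddTorus d), ∫⁻ ω : Metric.sphere (0 : EuclideanSpace ℝ d) 1,
          ENNReal.ofReal (ε ^ (Fintype.card d - 1) * ⟪((ω : EuclideanSpace ℝ d)), (z a).2 - (z b).2⟫) *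
            Bad.indicator G (contactInsert ε a b (ω : EuclideanSpace ℝ d) z)
          ∂(volume : Measure (EuclideanSpace ℝ d)).toSphere := by
        have hmT := campbell_measurable_setFluxIntegrand ε hTm hG a b
        rw [← lintegral_add_left hmT.lintegral_prod_right']
        refine lintegral_congr fun z => ?_
        exact lintegral_add_left (hmT.comp measurable_prodMk_left) _
    _ = _ := by rw [hbad0, add_zero]

end

end Literature.MathematicalPhysics.KineticTheory
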